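import Summits.QuantumFields.YangMills.Theorems.UnitScaleTiltProp7CmapSymInputs
import Summits.QuantumFields.YangMills.Theorems.UnitScaleTiltProp7SymAvgTwGaugeDir
import HarnessLib

/-!
# `UnitScaleTiltProp7SymAvgRelDiffT3` — THE DISPLAYED ROW `hG` OF THE Σ-TWIST BRIDGES, DISCHARGED FROM `RegPr`: at a printed-regular background (`RegPr F n K ε₀ U₀`, `10⁷L³ε₀ ≤ 1`) the
# RELATIVE DESCENDED PERTURBATION `G(A)(c) = D̄_GL(e^{A}U₀)(c)·D̄_GL(U₀)(c)⁻¹` (the argument of `logChartSym`; ★w4-20520 g2's «relative iterate» at the T³ letters) is ANALYTIC at `A = 0`, hence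
# `HasFDerivAt G (fderiv G 0) 0` — the hypothesis `hG` of `Prop7SymAvgTwBridge.hasFDerivAt_logChartTw` ∕ `QTw_eq_QSym_sub` ∕ `Prop7SymAvgTwRightInverse` ∕ `Prop7SymAvgTwGaugeDir` — and
# `logChartSym U₀` is differentiable at `0` — the hypothesis `hS` of `Prop7QSymGaugeCovariance.QSym_gaugeDir`, which therefore holds UNCONDITIONALLY at printed-regular backgrounds:
# **`QSym U₀ (D_{U₀}λ) = D_{Ū₀}(λ↓)`**
# (route `UnitScaleTilt`, crux K1 «MinimiserStabilityRegPr» stmt-QuantumFields-19200, stub `stub_existenceMinimalOrbit` (EX), route (α), (AVG-SYM); OWNER RULING g26-№1 Σ-TWIST (T); def-free,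
# count-neutral)

Cell `ym3-torus` (HUMAN RULING D-0037, YM ladder rung R3 — YM₃ on T³ is a rung, not d = 4, not a mass gap, not Clay), width seat `ym-ust-20520-w5` (gen 3).

THE TOOLS (by name).  ★w4-20520 g2: `Prop7SymAvgRelativeAnalytic.analyticAt_relIter_of_plaqSmall` (the relative `k`-fold (0.4) average is analytic on the k-uniform sup-ball at a plaquette-small
SU(2) background), `Prop7CmapSymInputs.budget_T3` ∕ `perturbedField_eq` (the T³ budget from `10⁷L³ε₀ ≤ 1` and the rescaling `e^{A} = e^{iη·((iη)⁻¹A)}`); ★w1-19200 g2: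
`Prop7SymAvgGL.descendToGL_eq_fieldShift_emlIterU`.

WHAT IS PROVED (sorry-free, no definition):
* ★**`analyticAt_rel_zero_of_regPr`** — `AnalyticAt ℂ (A ↦ G(A)(c)) 0` for every comparison bond `c`; ★**`hasFDerivAt_rel_of_regPr`** — `HasFDerivAt G (fderiv ℂ G 0) 0` (= `hG`);
  ★**`differentiableAt_logChartSym_zero_of_regPr`** (= `hS`); ★★**`QSym_gaugeDir_of_regPr`** — `Prop7QSymGaugeCovariance.QSym_gaugeDir` with `hS` discharged.
HONEST FRAMING.  Plumbing over landed theorems; nothing of print is asserted; the frames' row `hr` (lit-balaban `B7Prop6GeneralAnalytic.analyticAt_vcovQ`) is NOT discharged here.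
`--supports stmt-QuantumFields-19200 --as helper`.

References: T. Bałaban, CMP 109 (1987) 249–301 [Balaban1987RG1] ((0.4) p.253, (0.21) p.256); CMP 98 (1985) 17–51 [Balaban1985Averaging] ((11)–(12) p.19, Prop. 4 (134)–(135) p.38);
CMP 102 (1985) 277–309 [Balaban1985Variational] ((6) p.278, (44) p.285, (152) p.301).
-/

set_option autoImplicit false

noncomputable section

open scoped Matrix.Norms.L2Operator Topology

namespace Summit.QuantumFields.YangMills.Theorems.Prop7SymAvgRelDiffT3

open NormedSpace Metric Set
open Literature.MathematicalPhysics.QuantumFieldTheory.Balaban1983to89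
open Literature.MathematicalPhysics.QuantumFieldTheory.Balaban1983to89.T3ContinuumYM3Torus
open T3RegularMinimiser (regThreshold)
open T3PrintedRegularMinimiser (RegPr)
open T3LevelShift (siteShift)
open T3PrintedRegularOrbits (sites_eq)
open T3SectALandauChart (bgUnits)
open B15DeterminingSets (embIter)
open B7Prop1Explicit (expUnit val_expUnit)
open B10Eq27TorusAxialLog (unitsField toUField)
open Summit.QuantumFields.YangMills.Theorems.Prop8Chart (expCfg coe_expCfg emlIterU)
open Summit.QuantumFields.YangMills.Theorems.Prop7SymAvgGL (descendToGL logChartSym QSym descendToGL_eq_fieldShift_emlIterU)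
open Summit.QuantumFields.YangMills.Theorems.Prop7SymAvgRelativeBound (analyticAt_relIter_of_plaqSmall budget_T3 perturbedField_eq)
open Summit.QuantumFields.YangMills.Theorems.Prop7QSymGaugeCovariance (QSym_gaugeDir)
open Summit.QuantumFields.YangMills.Theorems.Prop7SymAvgTwGaugeDir (hasFDerivAt_logChartSym)

variable (F : T3Family) {n K : ℕ} (h : n ≤ K)

/-- ★ **THE RELATIVE DESCENDED PERTURBATION IS ANALYTIC AT `A = 0` AT A PRINTED-REGULAR BACKGROUND**, bond by bond: `A ↦ D̄_GL(e^{A}U₀)(c)·D̄_GL(U₀)(c)⁻¹` is analytic at `0` for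
`RegPr F n K ε₀ U₀`, `10⁷L³ε₀ ≤ 1` (★w4's `analyticAt_relIter_of_plaqSmall` at the rescaled exponent `(iη)⁻¹A`, `η = L^{−(K−n)}`, through `descendToGL = fieldShift ∘ emlIterU`).
[cite: Balaban1987RG1, (0.4) p.253, (0.21) p.256; Balaban1985Averaging, Prop. 4 (134)–(135) p.38] -/
theorem analyticAt_rel_zero_of_regPr {ε₀ : ℝ} (hε₀ : 0 < ε₀) (hε : 10 ^ 7 * (F.L : ℝ) ^ 3 * ε₀ ≤ 1)
    (U₀ : GaugeField (F.P K) 0 (Matrix.specialUnitaryGroup (Fin 2) ℂ)) (hreg : RegPr F n K ε₀ U₀) (c : PBond (F.P n) 0) :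
    AnalyticAt ℂ (fun A : PBond (F.P K) 0 → Matrix (Fin 2) (Fin 2) ℂ =>
      ((descendToGL F n K h (fun b => expUnit (A b) * bgUnits F K U₀ b) c : (Matrix (Fin 2) (Fin 2) ℂ)ˣ) : Matrix (Fin 2) (Fin 2) ℂ)
        * (((descendToGL F n K h (bgUnits F K U₀) c)⁻¹ : (Matrix (Fin 2) (Fin 2) ℂ)ˣ) : Matrix (Fin 2) (Fin 2) ℂ)) 0 := by
  -- letters (as in ★w4's `inputs_CmapSym`)
  have hd : (F.P K).d = 3 := T3Family.P_d F K
  have hLL : ((F.P K).L : ℝ) = F.L := rfl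
  have hL3 : 3 ≤ F.L := by obtain ⟨a, ha⟩ := F.hL.1; have := F.hL.2; omega
  have hL3r : (3 : ℝ) ≤ F.L := by exact_mod_cast hL3
  have hL0 : (0 : ℝ) < F.L := by linarith
  have hk1 : K - n + 1 ≤ (F.P K).m + (F.P K).K := by
    show K - n + 1 ≤ F.m + K; have := F.hm; omega
  set η : ℝ := ((F.L : ℝ)⁻¹) ^ (K - n) with hη
  have hη0 : 0 < η := by positivity
  have hηne : η ≠ 0 := hη0.ne'
  set r : ℝ := 1 / (10 ^ 6 * (F.L : ℝ) ^ 2) with hr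
  have hr0 : 0 ≤ r := by positivity
  have hrr : 10 ^ 6 * (F.L : ℝ) ^ 2 * r ≤ 1 := by rw [hr, mul_one_div_cancel (by positivity)]
  set a₀ : ℝ := regThreshold F n K ε₀ with ha₀
  have ha₀0 : 0 < a₀ := by rw [ha₀]; unfold regThreshold; positivity
  have hXa : (F.L : ℝ) ^ (K - n) * ((F.L : ℝ) ^ (K - n) * a₀) = ε₀ := by
    have hX2 : (F.L : ℝ) ^ (K - n) * (F.L : ℝ) ^ (K - n) = (F.L : ℝ) ^ (2 * (K - n)) := by rw [← pow_add, two_mul]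
    have ha : a₀ = ε₀ * ((F.L : ℝ) ^ (2 * (K - n)))⁻¹ := by rw [ha₀]; unfold regThreshold; rw [inv_pow]
    rw [← mul_assoc, hX2, ha, mul_comm ε₀, ← mul_assoc, mul_inv_cancel₀ (pow_ne_zero _ hL0.ne'), one_mul]
  have hU : PlaqSmall a₀ U₀ := hreg.1
  obtain ⟨ht1, hbudget, -, -⟩ := budget_T3 F (K - n) hε₀ hε hr0 hrr ha₀0.le hXa
  -- the rescaling `A ↦ (iη)⁻¹A` and the top bond
  set σ : (PBond (F.P K) 0 → Matrix (Fin 2) (Fin 2) ℂ) →L[ℂ] (PBond (F.P K) 0 → Matrix (Fin 2) (Fin 2) ℂ) :=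
    (Complex.I * (η : ℂ))⁻¹ • ContinuousLinearMap.id ℂ (PBond (F.P K) 0 → Matrix (Fin 2) (Fin 2) ℂ) with hσ
  have hσ_apply : ∀ A : PBond (F.P K) 0 → Matrix (Fin 2) (Fin 2) ℂ, σ A = fun b => (Complex.I * (η : ℂ))⁻¹ • A b := fun A => by
    rw [hσ]; rfl
  have hσ0 : σ 0 = 0 := map_zero σ
  set e : PBond (F.P K) (K - n) :=
    T3LevelShift.bondShift (F.sitesPerDir_eq (m := F.m) (K := n) (j := 0) (m' := F.m) (K' := K) (j' := K - n) (by omega)) c with he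
  -- reads at `A₀ = 0`: `‖η·σ(0)(b)‖ = 0 ≤ ηr`
  have hreads : ∀ b, ‖(η : ℂ) • σ 0 b‖ ≤ η * r := fun b => by
    rw [hσ0, Pi.zero_apply, smul_zero, norm_zero]; positivity
  -- ★w4's analyticity at the rescaled exponent
  have h1 := analyticAt_relIter_of_plaqSmall hk1 U₀ ha₀0 hU η (σ 0) ht1 hreads (by rw [hd, hLL]; exact hbudget) e
  have h2 : AnalyticAt ℂ (fun A : PBond (F.P K) 0 → Matrix (Fin 2) (Fin 2) ℂ =>
      ((emlIterU (K - n) (fun b => expCfg η (σ A) b * unitsField (toUField U₀) b) e : (Matrix (Fin 2) (Fin 2) ℂ)ˣ) : Matrix (Fin 2) (Fin 2) ℂ) *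
        (((emlIterU (K - n) (unitsField (toUField U₀)) e)⁻¹ : (Matrix (Fin 2) (Fin 2) ℂ)ˣ) : Matrix (Fin 2) (Fin 2) ℂ)) 0 :=
    AnalyticAt.comp_of_eq h1 (σ.analyticAt 0) rfl
  -- the junction with ★w1's letters
  have hfun : (fun A : PBond (F.P K) 0 → Matrix (Fin 2) (Fin 2) ℂ =>
      ((descendToGL F n K h (fun b => expUnit (A b) * bgUnits F K U₀ b) c : (Matrix (Fin 2) (Fin 2) ℂ)ˣ) : Matrix (Fin 2) (Fin 2) ℂ)
        * (((descendToGL F n K h (bgUnits F K U₀) c)⁻¹ : (Matrix (Fin 2) (Fin 2) ℂ)ˣ) : Matrix (Fin 2) (Fin 2) ℂ))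
      = fun A => ((emlIterU (K - n) (fun b => expCfg η (σ A) b * unitsField (toUField U₀) b) e : (Matrix (Fin 2) (Fin 2) ℂ)ˣ) : Matrix (Fin 2) (Fin 2) ℂ) *
        (((emlIterU (K - n) (unitsField (toUField U₀)) e)⁻¹ : (Matrix (Fin 2) (Fin 2) ℂ)ˣ) : Matrix (Fin 2) (Fin 2) ℂ) := by
    funext A
    rw [descendToGL_eq_fieldShift_emlIterU, descendToGL_eq_fieldShift_emlIterU, perturbedField_eq F K hηne U₀ A, hσ_apply]
    rfl
  rw [hfun]
  exact h2

/-- ★ **`hG` OF THE Σ-TWIST BRIDGES, DISCHARGED**: at a printed-regular background, `G : A ↦ (c ↦ D̄_GL(e^{A}U₀)(c)·D̄_GL(U₀)(c)⁻¹)` satisfies `HasFDerivAt G (fderiv ℂ G 0) 0`.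
[cite: Balaban1987RG1, (0.4) p.253; Balaban1985Variational, (44) p.285] -/
theorem hasFDerivAt_rel_of_regPr {ε₀ : ℝ} (hε₀ : 0 < ε₀) (hε : 10 ^ 7 * (F.L : ℝ) ^ 3 * ε₀ ≤ 1)
    (U₀ : GaugeField (F.P K) 0 (Matrix.specialUnitaryGroup (Fin 2) ℂ)) (hreg : RegPr F n K ε₀ U₀) :
    HasFDerivAt (fun A : PBond (F.P K) 0 → Matrix (Fin 2) (Fin 2) ℂ => fun c : PBond (F.P n) 0 =>
        ((descendToGL F n K h (fun b => expUnit (A b) * bgUnits F K U₀ b) c : (Matrix (Fin 2) (Fin 2) ℂ)ˣ) : Matrix (Fin 2) (Fin 2) ℂ)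
          * (((descendToGL F n K h (bgUnits F K U₀) c)⁻¹ : (Matrix (Fin 2) (Fin 2) ℂ)ˣ) : Matrix (Fin 2) (Fin 2) ℂ))
      (fderiv ℂ (fun A : PBond (F.P K) 0 → Matrix (Fin 2) (Fin 2) ℂ => fun c : PBond (F.P n) 0 =>
        ((descendToGL F n K h (fun b => expUnit (A b) * bgUnits F K U₀ b) c : (Matrix (Fin 2) (Fin 2) ℂ)ˣ) : Matrix (Fin 2) (Fin 2) ℂ)
          * (((descendToGL F n K h (bgUnits F K U₀) c)⁻¹ : (Matrix (Fin 2) (Fin 2) ℂ)ˣ) : Matrix (Fin 2) (Fin 2) ℂ)) 0) 0 := by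
  have hdiff : DifferentiableAt ℂ (fun A : PBond (F.P K) 0 → Matrix (Fin 2) (Fin 2) ℂ => fun c : PBond (F.P n) 0 =>
      ((descendToGL F n K h (fun b => expUnit (A b) * bgUnits F K U₀ b) c : (Matrix (Fin 2) (Fin 2) ℂ)ˣ) : Matrix (Fin 2) (Fin 2) ℂ)
        * (((descendToGL F n K h (bgUnits F K U₀) c)⁻¹ : (Matrix (Fin 2) (Fin 2) ℂ)ˣ) : Matrix (Fin 2) (Fin 2) ℂ)) 0 :=
    differentiableAt_pi.2 fun c => (analyticAt_rel_zero_of_regPr F h hε₀ hε U₀ hreg c).differentiableAt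
  exact hdiff.hasFDerivAt

/-- ★ **`hS` DISCHARGED**: `logChartSym U₀` is differentiable at `0` at a printed-regular background (`Prop7SymAvgTwGaugeDir.hasFDerivAt_logChartSym` ∘ `hasFDerivAt_rel_of_regPr`).
[cite: Balaban1985Variational, (44) p.285; Balaban1987RG1, (0.4) p.253] -/
theorem differentiableAt_logChartSym_zero_of_regPr {ε₀ : ℝ} (hε₀ : 0 < ε₀) (hε : 10 ^ 7 * (F.L : ℝ) ^ 3 * ε₀ ≤ 1)
    (U₀ : GaugeField (F.P K) 0 (Matrix.specialUnitaryGroup (Fin 2) ℂ)) (hreg : RegPr F n K ε₀ U₀) :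
    DifferentiableAt ℂ (logChartSym F n K h U₀) 0 :=
  (hasFDerivAt_logChartSym F h U₀ (hasFDerivAt_rel_of_regPr F h hε₀ hε U₀ hreg)).differentiableAt

/-- ★★ **`QSym U₀ (D_{U₀}λ) = D_{Ū₀}(λ↓)` UNCONDITIONALLY AT PRINTED-REGULAR BACKGROUNDS** — the pinned covariance of the (AVG-SYM) core (`Prop7QSymGaugeCovariance.QSym_gaugeDir`) with its
differentiability hypothesis discharged from `RegPr F n K ε₀ U₀`, `10⁷L³ε₀ ≤ 1`. [cite: Balaban1985Averaging, (11) p.19, p.28; Balaban1985RegularSpaces, p.80; Balaban1987RG1, (0.11) p.253] -/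
theorem QSym_gaugeDir_of_regPr {ε₀ : ℝ} (hε₀ : 0 < ε₀) (hε : 10 ^ 7 * (F.L : ℝ) ^ 3 * ε₀ ≤ 1)
    (U₀ : GaugeField (F.P K) 0 (Matrix.specialUnitaryGroup (Fin 2) ℂ)) (hreg : RegPr F n K ε₀ U₀)
    (lam : Site (F.P K) 0 → Matrix (Fin 2) (Fin 2) ℂ) :
    QSym F n K h U₀ (fun b : PBond (F.P K) 0 =>
        lam b.src - ((bgUnits F K U₀ b : (Matrix (Fin 2) (Fin 2) ℂ)ˣ) : Matrix (Fin 2) (Fin 2) ℂ) * lam b.tgt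
          * (((bgUnits F K U₀ b)⁻¹ : (Matrix (Fin 2) (Fin 2) ℂ)ˣ) : Matrix (Fin 2) (Fin 2) ℂ))
      = fun c : PBond (F.P n) 0 =>
        lam (embIter (K - n) (siteShift (sites_eq F n K h) c.src))
          - ((descendToGL F n K h (bgUnits F K U₀) c : (Matrix (Fin 2) (Fin 2) ℂ)ˣ) : Matrix (Fin 2) (Fin 2) ℂ) * lam (embIter (K - n) (siteShift (sites_eq F n K h) c.tgt))
            * (((descendToGL F n K h (bgUnits F K U₀) c)⁻¹ : (Matrix (Fin 2) (Fin 2) ℂ)ˣ) : Matrix (Fin 2) (Fin 2) ℂ) :=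
  QSym_gaugeDir (h := h) U₀ (differentiableAt_logChartSym_zero_of_regPr F h hε₀ hε U₀ hreg) lam

end Summit.QuantumFields.YangMills.Theorems.Prop7SymAvgRelDiffT3

end
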